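import Summits.QuantumAdvantage.QuantumAdvantage.Theorems.LocusDialPointer
import Summits.QuantumAdvantage.AdviceFreeQNC0.WalkTubeRank
import HarnessLib

/-!
# LocusDialAffinePointerA — the character `χ` of `𝔽₃` and the two-state transfer recursion (part A of 3)

Cell decomp-qadv, seat lens-2, generation 17 — tree part «AffinePointer» of the node «LocusDial»/«StabilizerDial»
(supports item stmt-QuantumAdvantage-27137 `Theses.StabilizerDial.FewLocusLoss3` ≡ `Theorems.LocusDial.FewLocusLoss3`, whose
first necessary leaf is `AffinePointerLoss3`: tree chain `freePointerLoss3_of_fewLocusLoss3`, `affinePointerLoss3_of_freePointerLoss3`).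

THE THEOREM (part C, `affinePointerLoss3 : AffinePointerLoss3`, constant `C = 1`): in the mod-3 ring game on the odd class, a
strategy whose answer pointer is ANY lookup `π` of ANY `t ≤ (log₂ n)^c` `𝔽₃`-LINEAR FORMS of the input bits (`linHash`) hits a
kernel position (`gCond`) on at most `(1 - 1/n)·2^{n-1}` inputs — in fact on at most `3/4` of the odd class.

THE METHOD (new in the tree: a TRANSFER OPERATOR for the zero-parity walk).  The kernel condition at position `k` reads
`φ_k(x) = k + n + W_k(x) + W(x) ≢ 2 (mod 3)` with `W_k` the occupation count of the prefix zero-parity walk `u_i(x)`.  On a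
fibre `{linHash M x = v}` the pointer is constant (`= π v`); the fibre indicator expands by `𝔽₃`-character orthogonality
(`sum_χ_lin`) into `3^{-t} Σ_λ χ(⟨λ, linHash x - v⟩)`, and each resulting sum `Σ_{x odd} χ(Σ_i μ_i[x_i] + a(W_k + W))` is computed
EXACTLY by a two-state recursion over the walk (`trR`, states = current parity; `trS_eq : S_k = 2^{n-k}·R_k`) whose `ℓ²`-mass
`trQ` contracts by `12/16` every two steps as soon as the occupation phase is nonzero (`trQ_two_step`; here `c_i = a(1 + [i<k])
≠ 0` for all `i < n-1`).  Hence every fibre sum is `≤ 2^n/(16·3^t)` once `n ≥ 16t + 42` (`pow_budget`), the losing inputs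
(`φ = 2`) number `≥ (#odd - 2^n/8)/3 ≥ 2^{n-3}` by pointwise orthogonality (`fibre_count`), and the wins are `≤ 2^{n-1} - 2^{n-3}`.
`t ≤ (log₂ n)^c ≤ √n` eventually is the tree's `TubePlanProof.logPow_le_natSqrt`.

WHAT THIS IS NOT: it is not `FreePointerLoss3` (pointer = arbitrary low-degree polynomials) nor `U = FewLocusLoss3`; the
transfer operator handles phases that are LINEAR in the bits plus the two occupation counts — the degree-`(log n)^c` pointer
of `U` is the next rung (g18).  No `sorry`; standard axioms; no instances, no notation.

PART A (this file): §A the primitive cube root `ω3 : ℂ` given by coordinates, the additive character `χ s = ω3^{s.val}`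
(`χ_add`, `χ_re`, `one_add_χ_add_χ`, the orthogonality relations `sum_χ_mul`, `sum_χ_lin`); §B the transfer recursion `trR`,
its `ℓ²`-mass `trQ`, the one-step bound `trQ_succ_le` (`≤ 4·`), the contraction `trQ_succ_le_of_ne` (`≤ 3·` when the bit
phase is nonzero), the two-step contraction `trQ_two_step` (`≤ 12·` when the occupation phase is nonzero) and the
closed-form bound `normSq_trR_le`.
-/

set_option linter.dupNamespace false

noncomputable section

open scoped Classical

namespace Summit.QuantumAdvantage.QuantumAdvantage.Theorems.LocusDial

open Finset
open Literature.Computability.QuantumComplexity Literature.Computability.QuantumComplexity.RingHLF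
open Summit.QuantumAdvantage.AdviceFreeQNC0
open Summit.QuantumAdvantage.QuantumAdvantage.Theorems.HolonomyDial (gCond)

/-! ## §A  The primitive cube root of unity `ω` and the additive character `χ` of `𝔽₃` -/

/-- `ω = e^{2πi/3} = (-1 + i√3)/2`. -/
def ω3 : ℂ := ⟨-1 / 2, Real.sqrt 3 / 2⟩

/-- LocusDialAffinePointerA helper `sqrt3_mul_self` (decomp-qadv land package; see the module docstring). -/
theorem sqrt3_mul_self : Real.sqrt 3 * Real.sqrt 3 = 3 := Real.mul_self_sqrt (by norm_num)

/-- LocusDialAffinePointerA helper `ω3_sq` (decomp-qadv land package; see the module docstring). -/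
theorem ω3_sq : ω3 ^ 2 = ⟨-1 / 2, -(Real.sqrt 3 / 2)⟩ := by
  apply Complex.ext
  · simp only [sq, ω3, Complex.mul_re]
    linear_combination (-1 / 4 : ℝ) * sqrt3_mul_self
  · simp only [sq, ω3, Complex.mul_im]
    ring

/-- LocusDialAffinePointerA helper `ω3_cube` (decomp-qadv land package; see the module docstring). -/
theorem ω3_cube : ω3 ^ 3 = 1 := by
  rw [pow_succ, ω3_sq]
  apply Complex.ext
  · simp only [ω3, Complex.mul_re, Complex.one_re]
    linear_combination (1 / 4 : ℝ) * sqrt3_mul_self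
  · simp only [ω3, Complex.mul_im, Complex.one_im]
    ring

/-- LocusDialAffinePointerA helper `ω3_re` (decomp-qadv land package; see the module docstring). -/
theorem ω3_re : ω3.re = -1 / 2 := rfl

/-- LocusDialAffinePointerA helper `ω3_sq_re` (decomp-qadv land package; see the module docstring). -/
theorem ω3_sq_re : (ω3 ^ 2).re = -1 / 2 := by rw [ω3_sq]

/-- LocusDialAffinePointerA helper `normSq_ω3` (decomp-qadv land package; see the module docstring). -/
theorem normSq_ω3 : Complex.normSq ω3 = 1 := by
  simp only [Complex.normSq_apply, ω3]
  linear_combination (1 / 4 : ℝ) * sqrt3_mul_self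

/-- `ω^{m mod 3} = ω^m`. -/
theorem ω3_pow_mod (m : ℕ) : ω3 ^ (m % 3) = ω3 ^ m := by
  conv_rhs => rw [← Nat.div_add_mod m 3, pow_add, pow_mul, ω3_cube, one_pow, one_mul]

/-- the additive character `χ(s) = ω^s` of `ZMod 3`. -/
def χ (s : ZMod 3) : ℂ := ω3 ^ s.val

/-- LocusDialAffinePointerA helper `χ_zero` (decomp-qadv land package; see the module docstring). -/
theorem χ_zero : χ 0 = 1 := by simp [χ]

/-- LocusDialAffinePointerA helper `val_one_zmod3` (decomp-qadv land package; see the module docstring). -/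
theorem val_one_zmod3 : (1 : ZMod 3).val = 1 := rfl

/-- LocusDialAffinePointerA helper `val_two_zmod3` (decomp-qadv land package; see the module docstring). -/
theorem val_two_zmod3 : (2 : ZMod 3).val = 2 := rfl

/-- LocusDialAffinePointerA helper `χ_one` (decomp-qadv land package; see the module docstring). -/
theorem χ_one : χ 1 = ω3 := by rw [χ, val_one_zmod3, pow_one]

/-- LocusDialAffinePointerA helper `χ_two` (decomp-qadv land package; see the module docstring). -/
theorem χ_two : χ 2 = ω3 ^ 2 := by rw [χ, val_two_zmod3]

/-- LocusDialAffinePointerA helper `χ_add` (decomp-qadv land package; see the module docstring). -/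
theorem χ_add (a b : ZMod 3) : χ (a + b) = χ a * χ b := by
  unfold χ
  rw [ZMod.val_add, ω3_pow_mod, pow_add]

/-- LocusDialAffinePointerA helper `χ_sum` (decomp-qadv land package; see the module docstring). -/
theorem χ_sum {ι : Type*} (S : Finset ι) (f : ι → ZMod 3) : χ (∑ s ∈ S, f s) = ∏ s ∈ S, χ (f s) := by
  induction S using Finset.induction_on with
  | empty => simp [χ_zero]
  | insert a S ha ih => rw [sum_insert ha, prod_insert ha, χ_add, ih]

/-- LocusDialAffinePointerA helper `normSq_χ` (decomp-qadv land package; see the module docstring). -/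
theorem normSq_χ (s : ZMod 3) : Complex.normSq (χ s) = 1 := by
  unfold χ
  rw [map_pow, normSq_ω3, one_pow]

/-- LocusDialAffinePointerA helper `norm_χ` (decomp-qadv land package; see the module docstring). -/
theorem norm_χ (s : ZMod 3) : ‖χ s‖ = 1 := by
  have h := normSq_χ s
  rw [Complex.normSq_eq_norm_sq] at h
  nlinarith [norm_nonneg (χ s)]

/-- LocusDialAffinePointerA helper `univ_zmod3` (decomp-qadv land package; see the module docstring). -/
theorem univ_zmod3 : (univ : Finset (ZMod 3)) = {0, 1, 2} := by decide

/-- LocusDialAffinePointerA helper `χ_re` (decomp-qadv land package; see the module docstring). -/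
theorem χ_re (s : ZMod 3) : (χ s).re = if s = 0 then 1 else -1 / 2 := by
  have hs : s ∈ (univ : Finset (ZMod 3)) := mem_univ s
  rw [univ_zmod3] at hs
  simp only [mem_insert, mem_singleton] at hs
  rcases hs with rfl | rfl | rfl
  · rw [χ_zero, if_pos rfl, Complex.one_re]
  · rw [χ_one, if_neg (by decide), ω3_re]
  · rw [χ_two, if_neg (by decide), ω3_sq_re]

/-- LocusDialAffinePointerA helper `χ_re_of_ne` (decomp-qadv land package; see the module docstring). -/
theorem χ_re_of_ne {s : ZMod 3} (hs : s ≠ 0) : (χ s).re = -1 / 2 := by rw [χ_re, if_neg hs]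

/-- LocusDialAffinePointerA helper `one_add_ω3_add_sq` (decomp-qadv land package; see the module docstring). -/
theorem one_add_ω3_add_sq : 1 + ω3 + ω3 ^ 2 = 0 := by
  rw [ω3_sq]
  apply Complex.ext
  · simp [ω3]; norm_num
  · simp [ω3]

/-- pointwise orthogonality: `1 + χ(w) + χ(2w) = 3·[w = 0]`. -/
theorem one_add_χ_add_χ (w : ZMod 3) : 1 + χ w + χ (2 * w) = if w = 0 then 3 else 0 := by
  have hw : w ∈ (univ : Finset (ZMod 3)) := mem_univ w
  rw [univ_zmod3] at hw
  simp only [mem_insert, mem_singleton] at hw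
  rcases hw with rfl | rfl | rfl
  · rw [mul_zero, χ_zero, if_pos rfl]; norm_num
  · rw [mul_one, χ_one, χ_two, if_neg (by decide), one_add_ω3_add_sq]
  · rw [show (2 * 2 : ZMod 3) = 1 from by decide, χ_one, χ_two, if_neg (by decide), ← one_add_ω3_add_sq]
    ring

/-- orthogonality on `ZMod 3`: `Σ_a χ(a·w) = 3·[w = 0]`. -/
theorem sum_χ_mul (w : ZMod 3) : ∑ a : ZMod 3, χ (a * w) = if w = 0 then 3 else 0 := by
  rw [← one_add_χ_add_χ w, univ_zmod3, sum_insert (by decide), sum_insert (by decide), sum_singleton,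
    zero_mul, one_mul, χ_zero]
  ring

/-- orthogonality on `(ZMod 3)^t`: `Σ_λ χ(⟨λ, w⟩) = 3^t·[w = 0]`. -/
theorem sum_χ_lin (t : ℕ) (w : Fin t → ZMod 3) :
    ∑ lam : Fin t → ZMod 3, χ (∑ s : Fin t, lam s * w s) = if w = 0 then (3 : ℂ) ^ t else 0 := by
  have h1 : ∀ lam : Fin t → ZMod 3, χ (∑ s : Fin t, lam s * w s) = ∏ s : Fin t, χ (lam s * w s) :=
    fun lam => χ_sum _ _
  simp_rw [h1]
  rw [← Fintype.piFinset_univ, ← Finset.prod_univ_sum (fun _ : Fin t => (univ : Finset (ZMod 3)))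
    (fun s a => χ (a * w s))]
  simp_rw [sum_χ_mul]
  by_cases hw : w = 0
  · subst hw
    simp
  · rw [if_neg hw]
    have : ∃ s, w s ≠ 0 := by
      by_contra h
      push Not at h
      exact hw (funext h)
    obtain ⟨s, hs⟩ := this
    exact Finset.prod_eq_zero (mem_univ s) (by rw [if_neg hs])

/-! ## §B  The two-state transfer recursion and its `ℓ²` contraction -/

/-- the transfer vector `R_k(u)` of the walk with bit phases `μ` and occupation phases `c`. -/
def trR (μ c : ℕ → ZMod 3) : ℕ → Bool → ℂ
  | 0, u => if u then 0 else 1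
  | k + 1, u => χ (if u then c k else 0) * (χ (μ k) * trR μ c k u + trR μ c k (!u))

/-- the `ℓ²` mass `Q_k = |R_k(0)|² + |R_k(1)|²`. -/
def trQ (μ c : ℕ → ZMod 3) (k : ℕ) : ℝ :=
  Complex.normSq (trR μ c k false) + Complex.normSq (trR μ c k true)

/-- LocusDialAffinePointerA helper `trQ_nonneg` (decomp-qadv land package; see the module docstring). -/
theorem trQ_nonneg (μ c : ℕ → ZMod 3) (k : ℕ) : 0 ≤ trQ μ c k :=
  add_nonneg (Complex.normSq_nonneg _) (Complex.normSq_nonneg _)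

/-- LocusDialAffinePointerA helper `trQ_zero` (decomp-qadv land package; see the module docstring). -/
theorem trQ_zero (μ c : ℕ → ZMod 3) : trQ μ c 0 = 1 := by
  simp [trQ, trR]

/-- LocusDialAffinePointerA helper `re_mul_conj_le` (decomp-qadv land package; see the module docstring). -/
theorem re_mul_conj_le (A B : ℂ) :
    |(A * (starRingEnd ℂ) B).re| ≤ (Complex.normSq A + Complex.normSq B) / 2 := by
  rw [abs_le]
  simp only [Complex.mul_re, Complex.conj_re, Complex.conj_im, Complex.normSq_apply]
  constructor
  · nlinarith [sq_nonneg (A.re + B.re), sq_nonneg (A.im + B.im)]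
  · nlinarith [sq_nonneg (A.re - B.re), sq_nonneg (A.im - B.im)]

/-- LocusDialAffinePointerA helper `re_add_re_conj` (decomp-qadv land package; see the module docstring). -/
theorem re_add_re_conj (θ w : ℂ) : (θ * w).re + (θ * (starRingEnd ℂ) w).re = 2 * θ.re * w.re := by
  simp only [Complex.mul_re, Complex.conj_re, Complex.conj_im]
  ring

/-- the ONE-STEP IDENTITY `Q_{k+1} = 2 Q_k + 4·Re χ(μ_k)·Re(R_k(0)·conj R_k(1))`. -/
theorem trQ_succ (μ c : ℕ → ZMod 3) (k : ℕ) :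
    trQ μ c (k + 1) = 2 * trQ μ c k +
      4 * (χ (μ k)).re * (trR μ c k false * (starRingEnd ℂ) (trR μ c k true)).re := by
  set A := trR μ c k false with hA
  set B := trR μ c k true with hB
  have hf : trR μ c (k + 1) false = χ 0 * (χ (μ k) * A + B) := by
    simp [trR, hA, hB]
  have ht : trR μ c (k + 1) true = χ (c k) * (χ (μ k) * B + A) := by
    simp [trR, hA, hB]
  unfold trQ
  rw [hf, ht, map_mul, map_mul, normSq_χ, normSq_χ, one_mul, one_mul, Complex.normSq_add, Complex.normSq_add,
    map_mul, map_mul, normSq_χ, one_mul, one_mul]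
  have e1 : (χ (μ k) * B * (starRingEnd ℂ) A).re = (χ (μ k) * (starRingEnd ℂ) (A * (starRingEnd ℂ) B)).re := by
    rw [map_mul, Complex.conj_conj]; ring_nf
  rw [e1, mul_assoc (χ (μ k)) A]
  have e2 := re_add_re_conj (χ (μ k)) (A * (starRingEnd ℂ) B)
  rw [← hA, ← hB]
  nlinarith [e2]

/-- one step never more than quadruples the mass. -/
theorem trQ_succ_le (μ c : ℕ → ZMod 3) (k : ℕ) : trQ μ c (k + 1) ≤ 4 * trQ μ c k := by
  rw [trQ_succ]
  have h1 := re_mul_conj_le (trR μ c k false) (trR μ c k true)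
  have h2 : |(χ (μ k)).re| ≤ 1 := by
    rw [χ_re]; split_ifs <;> norm_num [abs_le]
  have h3 := abs_mul (χ (μ k)).re (trR μ c k false * (starRingEnd ℂ) (trR μ c k true)).re
  have hQ := trQ_nonneg μ c k
  unfold trQ at *
  nlinarith [abs_nonneg ((χ (μ k)).re), abs_nonneg ((trR μ c k false * (starRingEnd ℂ) (trR μ c k true)).re),
    le_abs_self ((χ (μ k)).re * (trR μ c k false * (starRingEnd ℂ) (trR μ c k true)).re),
    mul_le_mul h2 h1 (abs_nonneg _) (by norm_num : (0:ℝ) ≤ 1)]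

/-- a step with a NON-ZERO bit phase contracts the mass by `3/4`. -/
theorem trQ_succ_le_of_ne (μ c : ℕ → ZMod 3) (k : ℕ) (hμ : μ k ≠ 0) : trQ μ c (k + 1) ≤ 3 * trQ μ c k := by
  rw [trQ_succ, χ_re_of_ne hμ]
  have h1 := re_mul_conj_le (trR μ c k false) (trR μ c k true)
  unfold trQ at *
  nlinarith [neg_abs_le ((trR μ c k false * (starRingEnd ℂ) (trR μ c k true)).re),
    le_abs_self ((trR μ c k false * (starRingEnd ℂ) (trR μ c k true)).re)]

/-- the TWO-STEP CONTRACTION: if the occupation phase `c_k` is non-zero then `Q_{k+2} ≤ 12·Q_k` (against the trivial `16`). -/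
theorem trQ_two_step (μ c : ℕ → ZMod 3) (k : ℕ) (hc : c k ≠ 0) : trQ μ c (k + 2) ≤ 12 * trQ μ c k := by
  by_cases hμ : μ k = 0
  · -- aligned case: R_{k+1}(1) = χ(c_k)·R_{k+1}(0)
    set A := trR μ c k false with hA
    set B := trR μ c k true with hB
    have hf : trR μ c (k + 1) false = A + B := by
      simp [trR, hA, hB, hμ, χ_zero]
    have ht : trR μ c (k + 1) true = χ (c k) * (A + B) := by
      simp [trR, hA, hB, hμ, χ_zero, add_comm]
    have hQ1 : trQ μ c (k + 1) = 2 * Complex.normSq (A + B) := by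
      unfold trQ; rw [hf, ht, map_mul, normSq_χ]; ring
    have hw : (trR μ c (k + 1) false * (starRingEnd ℂ) (trR μ c (k + 1) true)).re =
        -1 / 2 * Complex.normSq (A + B) := by
      rw [hf, ht, map_mul, show (A + B) * ((starRingEnd ℂ) (χ (c k)) * (starRingEnd ℂ) (A + B)) =
        (starRingEnd ℂ) (χ (c k)) * ((A + B) * (starRingEnd ℂ) (A + B)) by ring, Complex.mul_conj,
        Complex.re_mul_ofReal, Complex.conj_re, χ_re_of_ne hc]
    have hstep : trQ μ c (k + 2) = 2 * trQ μ c (k + 1) +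
        4 * (χ (μ (k + 1))).re * (trR μ c (k + 1) false * (starRingEnd ℂ) (trR μ c (k + 1) true)).re :=
      trQ_succ μ c (k + 1)
    rw [hstep, hw, hQ1]
    have hre : -1 / 2 ≤ (χ (μ (k + 1))).re := by rw [χ_re]; split_ifs <;> norm_num
    have hAB : Complex.normSq (A + B) ≤ 2 * (Complex.normSq A + Complex.normSq B) := by
      rw [Complex.normSq_add]
      have := re_mul_conj_le A B
      nlinarith [le_abs_self ((A * (starRingEnd ℂ) B).re)]
    have hQk : trQ μ c k = Complex.normSq A + Complex.normSq B := rfl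
    rw [hQk]
    nlinarith [Complex.normSq_nonneg (A + B), hre]
  · calc trQ μ c (k + 2) ≤ 4 * trQ μ c (k + 1) := trQ_succ_le μ c (k + 1)
      _ ≤ 4 * (3 * trQ μ c k) := by
          have := trQ_succ_le_of_ne μ c k hμ; nlinarith
      _ = 12 * trQ μ c k := by ring

/-- iterated trivial bound. -/
theorem trQ_add_le (μ c : ℕ → ZMod 3) (m i : ℕ) : trQ μ c (m + i) ≤ 4 ^ i * trQ μ c m := by
  induction i with
  | zero => simp
  | succ i ih =>
    calc trQ μ c (m + (i + 1)) = trQ μ c (m + i + 1) := by rw [Nat.add_assoc]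
      _ ≤ 4 * trQ μ c (m + i) := trQ_succ_le μ c (m + i)
      _ ≤ 4 * (4 ^ i * trQ μ c m) := by nlinarith [ih]
      _ = 4 ^ (i + 1) * trQ μ c m := by ring

/-- iterated two-step bound: `Q_{2j} ≤ 12^j` as long as the occupation phases `c_0 … c_{2j-2}` are non-zero. -/
theorem trQ_even_le (μ c : ℕ → ZMod 3) (j : ℕ) (hc : ∀ i, i + 2 ≤ 2 * j → c i ≠ 0) :
    trQ μ c (2 * j) ≤ 12 ^ j := by
  induction j with
  | zero => simp [trQ_zero]
  | succ j ih =>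
    have ih' := ih (fun i hi => hc i (by omega))
    calc trQ μ c (2 * (j + 1)) = trQ μ c (2 * j + 2) := by ring_nf
      _ ≤ 12 * trQ μ c (2 * j) := trQ_two_step μ c (2 * j) (hc (2 * j) (by omega))
      _ ≤ 12 * 12 ^ j := by nlinarith [ih']
      _ = 12 ^ (j + 1) := by ring

/-- **the transfer bound**: with all occupation phases `c_i`, `i + 1 < N`, non-zero, `|R_N(1)|² ≤ 4^{N-2j}·12^j`, `j = ⌊(N-1)/2⌋`. -/
theorem normSq_trR_le (μ c : ℕ → ZMod 3) (N : ℕ) (hc : ∀ i, i + 1 < N → c i ≠ 0) :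
    Complex.normSq (trR μ c N true) ≤ 4 ^ (N - 2 * ((N - 1) / 2)) * 12 ^ ((N - 1) / 2) := by
  set j := (N - 1) / 2 with hj
  have h2j : 2 * j ≤ N := by omega
  have h1 : trQ μ c (2 * j) ≤ 12 ^ j := trQ_even_le μ c j (fun i hi => hc i (by omega))
  have h2 : trQ μ c N ≤ 4 ^ (N - 2 * j) * trQ μ c (2 * j) := by
    have := trQ_add_le μ c (2 * j) (N - 2 * j)
    rwa [Nat.add_sub_cancel' h2j] at this
  have h3 : Complex.normSq (trR μ c N true) ≤ trQ μ c N := by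
    unfold trQ; nlinarith [Complex.normSq_nonneg (trR μ c N false)]
  calc Complex.normSq (trR μ c N true) ≤ trQ μ c N := h3
    _ ≤ 4 ^ (N - 2 * j) * trQ μ c (2 * j) := h2
    _ ≤ 4 ^ (N - 2 * j) * 12 ^ j := by
        have : (0:ℝ) ≤ 4 ^ (N - 2 * j) := by positivity
        nlinarith [h1]


end Summit.QuantumAdvantage.QuantumAdvantage.Theorems.LocusDial
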